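import Summits.NavierStokesRegularity.NavierStokesRegularity.Theorems.QuarterLogPincerLogCubeCeilingTools
import Literature.Analysis.FluidPDE.KatoBilinearEstimates
import HarnessLib

/-!
# Tools for rung 1 of `QuarterLogPincer.LogCubeSharp` (item stmt-NavierStokesRegularity-23935):
# the `(5/8, 1/2)` time kernel, the `L⁴` Oseen slice bound, `L² ∩ L^∞ ⊂ L⁴`

Helper file (`--supports stmt-NavierStokesRegularity-23935`) of the crux `LogCubeSharp` of route
`QuarterLogPincer`. Rung 1 of the planner's ladder is the template-sharp `L⁴` bound
`‖u(t)‖_{L⁴} ≤ W₁ + W₂ (T−t)^{-1/8}` by the Oseen/Duhamel road (file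
`QuarterLogPincerLogCubeSharpLFour.lean`); this file holds its three solution-free lemmas:

* `lintegral_kernel_le_rpow_eighth` — `∫_{(0,s)} (s−τ)^{-5/8}(T−τ)^{-1/2} dτ ≤ (32/3)(T−s)^{-1/8}`
  for `0 < s < T` (split at `2s − T`: late piece `(8/3)(T−s)^{-1/8}`, early piece `8(T−s)^{-1/8}`);
  the `L⁴` size of the Oseen kernel gradient is `∝ (s−τ)^{-5/8}` and the enstrophy is spent at
  Leray's rate `(T−τ)^{-1/2}`, so the time integral scales to `(T−s)^{-1/8}`;
* `exists_eLpNorm_four_oseenSlice_le` — `‖e^{σΔ}P∇·(a⊗b)‖₄ ≤ C σ^{-5/8} ‖a‖₆ ‖b‖₆` on `ℝ³` (the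
  tree's interpolated Kato slice bound `exists_eLpNorm_oseenSlice_le` with `(p,q) = (3,4)` and
  Hölder);
* `eLpNorm_four_lt_top_of_bounded` — `L² ∩ L^∞ ⊂ L⁴`.

HONEST FRAMING: calculus and function-space lemmas; nothing here concerns Navier–Stokes regularity,
and the crux is NOT closed by this file. References: Kato 1984 §2 (2.3)–(2.5); Lemarié-Rieusset
2016 Thm. 7.5 (proof). [folklore]
-/

noncomputable section

open Set Filter Topology MeasureTheory Function
open scoped ENNReal NNReal
open Literature.Analysis Literature.Analysis.FluidPDE

namespace Summit.NavierStokesRegularity.NavierStokesRegularity.Theorems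

-- the problem directory repeats the summit name (`NavierStokesRegularity/NavierStokesRegularity`)
set_option linter.dupNamespace false

namespace LogCubeSharp

/-! ### The time integral: `∫₀ˢ (s−τ)^{-5/8}(T−τ)^{-1/2} dτ ≤ (32/3)(T−s)^{-1/8}` -/


/-- **The `L⁴` kernel integral.** For `0 < s < T`,
`∫_{(0,s)} (s−τ)^{-5/8} (T−τ)^{-1/2} dτ ≤ (32/3)·(T−s)^{-1/8}` (split at `max(0, 2s−T)`: on the
late piece `T−τ ≥ T−s` and `∫(s−τ)^{-5/8} ≤ (8/3)(T−s)^{3/8}`; on the early piece `T−τ ≥ s−τ ≥ T−s`,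
so the integrand is `≤ (s−τ)^{-9/8}`, which integrates to `≤ 8 (T−s)^{-1/8}`). [folklore] -/
theorem lintegral_kernel_le_rpow_eighth {s T : ℝ} (hs : 0 < s) (hsT : s < T) :
    ∫⁻ τ in Ioo 0 s, ENNReal.ofReal ((s - τ) ^ (-(5 / 8 : ℝ))) *
        ENNReal.ofReal ((T - τ) ^ (-(1 / 2 : ℝ))) ≤
      ENNReal.ofReal (32 / 3 * (T - s) ^ (-(1 / 8 : ℝ))) := by
  set s₀ : ℝ := max 0 (2 * s - T) with hs₀
  have hs₀0 : 0 ≤ s₀ := le_max_left _ _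
  have hs₀s : s₀ < s := max_lt hs (by linarith)
  have hs₀ge : 2 * s - T ≤ s₀ := le_max_right _ _
  have hTs : 0 < T - s := sub_pos.2 hsT
  have hT : 0 < T := hs.trans hsT
  have hR0 : 0 ≤ (T - s) ^ (-(1 / 8 : ℝ)) := Real.rpow_nonneg hTs.le _
  -- ### the late piece `(s₀, s)`
  have hA : ∫⁻ τ in Ioo s₀ s, ENNReal.ofReal ((s - τ) ^ (-(5 / 8 : ℝ))) *
      ENNReal.ofReal ((T - τ) ^ (-(1 / 2 : ℝ))) ≤ ENNReal.ofReal (8 / 3 * (T - s) ^ (-(1 / 8 : ℝ))) := by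
    calc ∫⁻ τ in Ioo s₀ s, ENNReal.ofReal ((s - τ) ^ (-(5 / 8 : ℝ))) *
          ENNReal.ofReal ((T - τ) ^ (-(1 / 2 : ℝ)))
        ≤ ∫⁻ τ in Ioo s₀ s, ENNReal.ofReal ((s - τ) ^ (-(5 / 8 : ℝ))) *
            ENNReal.ofReal ((T - s) ^ (-(1 / 2 : ℝ))) := by
          refine setLIntegral_mono' measurableSet_Ioo fun τ hτ => ?_
          exact mul_le_mul' le_rfl (ENNReal.ofReal_le_ofReal
            (Real.rpow_le_rpow_of_nonpos hTs (by linarith [hτ.2]) (by norm_num)))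
      _ = (∫⁻ τ in Ioo s₀ s, ENNReal.ofReal ((s - τ) ^ (-(5 / 8 : ℝ)))) *
            ENNReal.ofReal ((T - s) ^ (-(1 / 2 : ℝ))) :=
          lintegral_mul_const _ (measurable_ofReal_rpow_sub_left s (5 / 8))
      _ ≤ ENNReal.ofReal ((s - s₀) ^ (1 - 5 / 8 : ℝ) / (1 - 5 / 8)) *
            ENNReal.ofReal ((T - s) ^ (-(1 / 2 : ℝ))) :=
          mul_le_mul' (lintegral_Ioo_ofReal_rpow_neg_sub_le (γ := 5 / 8) (by norm_num)
            hs₀s.le le_rfl) le_rfl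
      _ = ENNReal.ofReal (8 / 3 * ((s - s₀) ^ (3 / 8 : ℝ) * (T - s) ^ (-(1 / 2 : ℝ)))) := by
          rw [← ENNReal.ofReal_mul (by positivity)]
          congr 1
          norm_num
          ring
      _ ≤ ENNReal.ofReal (8 / 3 * (T - s) ^ (-(1 / 8 : ℝ))) := by
          apply ENNReal.ofReal_le_ofReal
          have h1 : s - s₀ ≤ T - s := by linarith
          have h2 : (s - s₀) ^ (3 / 8 : ℝ) ≤ (T - s) ^ (3 / 8 : ℝ) :=
            Real.rpow_le_rpow (sub_nonneg.2 hs₀s.le) h1 (by norm_num)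
          have h3 : (T - s) ^ (3 / 8 : ℝ) * (T - s) ^ (-(1 / 2 : ℝ)) = (T - s) ^ (-(1 / 8 : ℝ)) := by
            rw [← Real.rpow_add hTs]; norm_num
          have h4 : 0 ≤ (T - s) ^ (-(1 / 2 : ℝ)) := Real.rpow_nonneg hTs.le _
          calc 8 / 3 * ((s - s₀) ^ (3 / 8 : ℝ) * (T - s) ^ (-(1 / 2 : ℝ)))
              ≤ 8 / 3 * ((T - s) ^ (3 / 8 : ℝ) * (T - s) ^ (-(1 / 2 : ℝ))) := by gcongr
            _ = 8 / 3 * (T - s) ^ (-(1 / 8 : ℝ)) := by rw [h3]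
  -- ### the early piece `(0, s₀)`
  have hB : ∫⁻ τ in Ioo 0 s₀, ENNReal.ofReal ((s - τ) ^ (-(5 / 8 : ℝ))) *
      ENNReal.ofReal ((T - τ) ^ (-(1 / 2 : ℝ))) ≤
        ENNReal.ofReal (8 * (T - s) ^ (-(1 / 8 : ℝ))) := by
    rcases eq_or_lt_of_le hs₀0 with h0 | hpos
    · rw [← h0, Ioo_self, Measure.restrict_empty, lintegral_zero_measure]
      exact bot_le
    · have hs₀eq : s₀ = 2 * s - T := by
        rcases le_total 0 (2 * s - T) with h | h
        · rw [hs₀, max_eq_right h]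
        · exfalso
          have : s₀ = 0 := by rw [hs₀, max_eq_left h]
          linarith
      have hss₀ : s - s₀ = T - s := by rw [hs₀eq]; ring
      -- integrability of the majorant `(s - τ)^{-9/8}` on `(0, s₀)`
      have hint : IntegrableOn (fun τ : ℝ => (s - τ) ^ (-(9 / 8 : ℝ))) (Ioo 0 s₀) volume := by
        have hc : ContinuousOn (fun τ : ℝ => (s - τ) ^ (-(9 / 8 : ℝ))) (Icc 0 s₀) := by
          refine ContinuousOn.rpow_const (continuous_const.sub continuous_id).continuousOn ?_
          intro τ hτ
          exact Or.inl (show (s - τ : ℝ) ≠ 0 by have := hτ.2; linarith)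
        exact (hc.integrableOn_Icc).mono_set Ioo_subset_Icc_self
      have hnn : 0 ≤ᵐ[volume.restrict (Ioo 0 s₀)] fun τ : ℝ => (s - τ) ^ (-(9 / 8 : ℝ)) := by
        refine (ae_restrict_iff' measurableSet_Ioo).2 (Eventually.of_forall fun τ hτ => ?_)
        exact Real.rpow_nonneg (by linarith [hτ.2]) _
      calc ∫⁻ τ in Ioo 0 s₀, ENNReal.ofReal ((s - τ) ^ (-(5 / 8 : ℝ))) *
            ENNReal.ofReal ((T - τ) ^ (-(1 / 2 : ℝ)))
          ≤ ∫⁻ τ in Ioo 0 s₀, ENNReal.ofReal ((s - τ) ^ (-(9 / 8 : ℝ))) := by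
            refine setLIntegral_mono' measurableSet_Ioo fun τ hτ => ?_
            have hsτ : 0 < s - τ := by linarith [hτ.2]
            have hTτ : 0 < T - τ := by linarith [hτ.2]
            have hle : s - τ ≤ T - τ := by linarith
            rw [← ENNReal.ofReal_mul (Real.rpow_nonneg hsτ.le _)]
            apply ENNReal.ofReal_le_ofReal
            have h1 : (T - τ) ^ (-(1 / 2 : ℝ)) ≤ (s - τ) ^ (-(1 / 2 : ℝ)) :=
              Real.rpow_le_rpow_of_nonpos hsτ hle (by norm_num)
            have h3 : (s - τ) ^ (-(5 / 8 : ℝ)) * (s - τ) ^ (-(1 / 2 : ℝ)) = (s - τ) ^ (-(9 / 8 : ℝ)) := by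
              rw [← Real.rpow_add hsτ]; norm_num
            calc (s - τ) ^ (-(5 / 8 : ℝ)) * (T - τ) ^ (-(1 / 2 : ℝ))
                ≤ (s - τ) ^ (-(5 / 8 : ℝ)) * (s - τ) ^ (-(1 / 2 : ℝ)) := by
                  gcongr
              _ = (s - τ) ^ (-(9 / 8 : ℝ)) := h3
        _ = ENNReal.ofReal (∫ τ in Ioo 0 s₀, (s - τ) ^ (-(9 / 8 : ℝ))) :=
            (ofReal_integral_eq_lintegral_ofReal hint hnn).symm
        _ = ENNReal.ofReal ((s ^ (-(9 / 8 : ℝ) + 1) - (s - s₀) ^ (-(9 / 8 : ℝ) + 1)) /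
              (-(9 / 8 : ℝ) + 1)) := by
            congr 1
            rw [← integral_Ioc_eq_integral_Ioo, ← intervalIntegral.integral_of_le hpos.le,
              intervalIntegral.integral_comp_sub_left (fun x : ℝ => x ^ (-(9 / 8 : ℝ))) s, sub_zero]
            refine integral_rpow (Or.inr ⟨by norm_num, ?_⟩)
            refine fun h => ?_
            have h' := (Set.mem_uIcc.1 h)
            rcases h' with h' | h'
            · linarith [h'.1]
            · linarith [h'.2]
        _ ≤ ENNReal.ofReal (8 * (T - s) ^ (-(1 / 8 : ℝ))) := by
            apply ENNReal.ofReal_le_ofReal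
            rw [hss₀]
            have e1 : (-(9 / 8 : ℝ) + 1) = -(1 / 8 : ℝ) := by norm_num
            rw [e1]
            have hspos : 0 ≤ s ^ (-(1 / 8 : ℝ)) := Real.rpow_nonneg hs.le _
            have : (s ^ (-(1 / 8 : ℝ)) - (T - s) ^ (-(1 / 8 : ℝ))) / (-(1 / 8 : ℝ)) =
                8 * (T - s) ^ (-(1 / 8 : ℝ)) - 8 * s ^ (-(1 / 8 : ℝ)) := by ring
            rw [this]
            linarith
  -- ### combine
  have hsub : Ioo 0 s ⊆ Ioo 0 s₀ ∪ Ico s₀ s := fun τ hτ => by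
    rcases lt_or_ge τ s₀ with h' | h'
    · exact Or.inl ⟨hτ.1, h'⟩
    · exact Or.inr ⟨h', hτ.2⟩
  calc ∫⁻ τ in Ioo 0 s, ENNReal.ofReal ((s - τ) ^ (-(5 / 8 : ℝ))) *
        ENNReal.ofReal ((T - τ) ^ (-(1 / 2 : ℝ)))
      ≤ ∫⁻ τ in Ioo 0 s₀ ∪ Ico s₀ s, ENNReal.ofReal ((s - τ) ^ (-(5 / 8 : ℝ))) *
          ENNReal.ofReal ((T - τ) ^ (-(1 / 2 : ℝ))) := lintegral_mono_set hsub
    _ ≤ (∫⁻ τ in Ioo 0 s₀, ENNReal.ofReal ((s - τ) ^ (-(5 / 8 : ℝ))) *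
          ENNReal.ofReal ((T - τ) ^ (-(1 / 2 : ℝ)))) +
        ∫⁻ τ in Ico s₀ s, ENNReal.ofReal ((s - τ) ^ (-(5 / 8 : ℝ))) *
          ENNReal.ofReal ((T - τ) ^ (-(1 / 2 : ℝ))) := lintegral_union_le _ _ _
    _ = (∫⁻ τ in Ioo 0 s₀, ENNReal.ofReal ((s - τ) ^ (-(5 / 8 : ℝ))) *
          ENNReal.ofReal ((T - τ) ^ (-(1 / 2 : ℝ)))) +
        ∫⁻ τ in Ioo s₀ s, ENNReal.ofReal ((s - τ) ^ (-(5 / 8 : ℝ))) *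
          ENNReal.ofReal ((T - τ) ^ (-(1 / 2 : ℝ))) := by
        rw [setLIntegral_congr (Ioo_ae_eq_Ico (μ := (volume : Measure ℝ)) (a := s₀) (b := s))]
    _ ≤ ENNReal.ofReal (8 * (T - s) ^ (-(1 / 8 : ℝ))) +
        ENNReal.ofReal (8 / 3 * (T - s) ^ (-(1 / 8 : ℝ))) := add_le_add hB hA
    _ = ENNReal.ofReal (32 / 3 * (T - s) ^ (-(1 / 8 : ℝ))) := by
        rw [← ENNReal.ofReal_add (by positivity) (by positivity)]
        congr 1
        ring

/-! ### The `L⁴` slice bound and `L² ∩ L^∞ ⊂ L⁴` -/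


/-- **`L⁴` size of an Oseen slice**: `‖e^{σΔ}P∇·(a⊗b)‖_{L⁴} ≤ C σ^{-5/8} ‖a‖_{L⁶} ‖b‖_{L⁶}` on `ℝ³`
(the tree's interpolated `Lᵖ → L^q` slice bound with `p = 3`, `q = 4`:
`−1/2 − (3/2)(1/3 − 1/4) = −5/8`, and Hölder `‖|a||b|‖₃ ≤ ‖a‖₆‖b‖₆`). [cite: LemarieRieusset2016, Thm. 7.5 (proof, PDF pp. 156–157)] -/
theorem exists_eLpNorm_four_oseenSlice_le :
    ∃ C : ℝ, 0 ≤ C ∧ ∀ {σ : ℝ}, 0 < σ →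
      ∀ {a b : EuclideanSpace ℝ (Fin 3) → EuclideanSpace ℝ (Fin 3)},
        AEStronglyMeasurable a volume → AEStronglyMeasurable b volume →
        eLpNorm (fun x => ∫ y, oseenKernel σ (x - y) (a y) (b y)) 4 volume ≤
          ENNReal.ofReal (C * σ ^ (-(5 / 8 : ℝ))) * (eLpNorm a 6 volume * eLpNorm b 6 volume) := by
  haveI := holderTriple_six_six_three
  obtain ⟨C, hC, h⟩ := exists_eLpNorm_oseenSlice_le (E := EuclideanSpace ℝ (Fin 3)) (p := 3) (q := 4)
    (by norm_num) (by norm_num) (by norm_num)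
  refine ⟨C, hC, fun {σ} hσ {a b} ha hb => ?_⟩
  have hexp : -(1 / 2 : ℝ) - (Module.finrank ℝ (EuclideanSpace ℝ (Fin 3)) : ℝ) / 2 *
      (1 / (3 : ℝ≥0∞).toReal - 1 / (4 : ℝ≥0∞).toReal) = -(5 / 8 : ℝ) := by
    rw [finrank_euclideanSpace_fin]; norm_num
  have h' := h hσ ha hb
  rw [hexp] at h'
  exact h'.trans (mul_le_mul' le_rfl (eLpNorm_norm_mul_norm_le ha hb 6 6 3))

/-- A bounded (`‖f‖ ≤ M`), square-integrable, measurable field on `ℝ³` has finite `L⁴` norm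
(`‖f‖₄ ≤ ‖f‖₂^{1/2} ‖f‖_∞^{1/2}`). [folklore] -/
theorem eLpNorm_four_lt_top_of_bounded
    {f : EuclideanSpace ℝ (Fin 3) → EuclideanSpace ℝ (Fin 3)} (hf : AEStronglyMeasurable f volume)
    {M : ℝ} (hM : ∀ x, ‖f x‖ ≤ M) (h2 : ∫⁻ x, ‖f x‖ₑ ^ 2 < ⊤) :
    eLpNorm f 4 volume < ⊤ := by
  have h2' : eLpNorm f 2 volume < ⊤ := by
    rw [eLpNorm_eq_lintegral_rpow_enorm_toReal two_ne_zero ENNReal.ofNat_ne_top, ENNReal.toReal_ofNat]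
    refine ENNReal.rpow_lt_top_of_nonneg (by norm_num) (ne_of_lt ?_)
    refine lt_of_le_of_lt (le_of_eq (lintegral_congr fun x => ?_)) h2
    rw [← ENNReal.rpow_natCast]; norm_num
  have htop : eLpNorm f ∞ volume < ⊤ := by
    refine lt_of_le_of_lt (eLpNorm_exponent_top (f := f) (μ := volume) ▸
      eLpNormEssSup_le_of_ae_enorm_bound (C := ENNReal.ofReal M)
        (Eventually.of_forall fun x => ?_)) ENNReal.ofReal_lt_top
    rw [← ofReal_norm]
    exact ENNReal.ofReal_le_ofReal (hM x)
  have hint := UnboundedOperators.eLpNorm_le_eLpNorm_rpow_mul_eLpNorm_top_rpow hf (p := 2) (q := 4)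
    two_ne_zero (by norm_num)
  refine lt_of_le_of_lt hint (ENNReal.mul_lt_top ?_ ?_)
  · exact ENNReal.rpow_lt_top_of_nonneg (by norm_num) h2'.ne
  · exact ENNReal.rpow_lt_top_of_nonneg (by norm_num) htop.ne

end LogCubeSharp

end Summit.NavierStokesRegularity.NavierStokesRegularity.Theorems

end
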